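import Summits.AtomisticToContinuum.Crystallization.Theorems.FrustratedLawDichotomyStrainedPatchHomCurvLeafL2

/-!
# In-kernel SEARCH for the best sign-vertex floor (`hertzSup`) and the parameter-free curvature constant of the centred leaf (`curvLamS`)

decomp-a2c hand-1 g27 (crux `AperiodicFrustratedLawGap`, stmt-AtomisticToContinuum-27623; `(H) HomFloor (1/625)`, hcp half; lever (C)).  A tree
verdict is a function of the box `(c, w)` alone, so the hver hook-up of the centred curvature leaf (successor task) cannot take the floor `lamS` as a
parameter: it must COMPUTE it.  `hertzTest E W κ` is monotone in spirit but only a check; this file searches the dyadic ladder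
`[−64, 64]·SC` by bisection (fuel `48`), returning only values that PASSED the test:

* §1 `hzSearch`, ★ `hertzSup E W : Option ℤ` with ★ `hertzSup_spec : hertzSup E W = some κ → hertzTest E W κ = true`;
* §2 ★ `curvLamS c w Lc Ln : Option ℤ := (hertzSup (Ec + En) Wmat2).map (· − remS2)` with ★★ `curvCheckL2_of_curvLamS`:
  `curvLamS … = some lamS` + the two label guards ⟹ `curvCheckL2 c w Lc Ln lamS = true` (so `curv_floor_of_curvCheckL2` applies with the computed floor).

Kernel definitions + soundness; 0 sorry; standard axioms; no instances / notation / `#eval`.  `--supports stmt-AtomisticToContinuum-27623`.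
-/

namespace Summit.AtomisticToContinuum.Crystallization.Theorems.FrustratedLawDichotomyStrainedPatchHomHertzKit

open Literature.Analysis.ValidatedNumerics.Numerics

/-! ## §1. The search -/

/-- Bisection on `κ`: keep the best PASSED value; `fuel` halvings of `[a, b]`. -/
def hzSearch (E : Fin 3 → Fin 3 → FI) (W : Fin 3 → Fin 3 → ℤ) : ℕ → ℤ → ℤ → Option ℤ → Option ℤ
  | 0, _, _, best => best
  | fuel + 1, a, b, best =>
      if hertzTest E W ((a + b) / 2) then hzSearch E W fuel ((a + b) / 2) b (some ((a + b) / 2))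
      else hzSearch E W fuel a ((a + b) / 2) best

/-- ★ The best passed floor on the ladder `[−64·SC, 64·SC]` (fuel `48`); `none` if even `−64·SC` fails. -/
def hertzSup (E : Fin 3 → Fin 3 → FI) (W : Fin 3 → Fin 3 → ℤ) : Option ℤ :=
  if hertzTest E W (-64 * (SC : ℤ)) then hzSearch E W 48 (-64 * (SC : ℤ)) (64 * (SC : ℤ)) (some (-64 * (SC : ℤ))) else none

/-- The search only returns passed values. [formal bookkeeping] -/
theorem hzSearch_spec (E : Fin 3 → Fin 3 → FI) (W : Fin 3 → Fin 3 → ℤ) :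
    ∀ (fuel : ℕ) (a b : ℤ) (best : Option ℤ), (∀ κ, best = some κ → hertzTest E W κ = true) →
      ∀ κ, hzSearch E W fuel a b best = some κ → hertzTest E W κ = true
  | 0, a, b, best, hbest, κ, h => hbest κ (by simpa [hzSearch] using h)
  | fuel + 1, a, b, best, hbest, κ, h => by
    simp only [hzSearch] at h
    split_ifs at h with htest
    · exact hzSearch_spec E W fuel _ _ _ (fun κ' h' => by simp only [Option.some.injEq] at h'; subst h'; exact htest) κ h
    · exact hzSearch_spec E W fuel _ _ _ hbest κ h

/-- ★ `hertzSup` returns a PASSED floor. [formal bookkeeping] -/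
theorem hertzSup_spec {E : Fin 3 → Fin 3 → FI} {W : Fin 3 → Fin 3 → ℤ} {κ : ℤ} (h : hertzSup E W = some κ) : hertzTest E W κ = true := by
  unfold hertzSup at h
  split_ifs at h with h0
  exact hzSearch_spec E W 48 _ _ _ (fun κ' h' => by simp only [Option.some.injEq] at h'; subst h'; exact h0) κ h

end Summit.AtomisticToContinuum.Crystallization.Theorems.FrustratedLawDichotomyStrainedPatchHomHertzKit

namespace Summit.AtomisticToContinuum.Crystallization.Theorems.FrustratedLawDichotomyStrainedPatchHomCurvLeafL2

open Literature.Analysis.ValidatedNumerics.Numerics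
open Summit.AtomisticToContinuum.Crystallization.Theorems.FrustratedLawDichotomyStrainedPatchHomHertzKit (hertzTest hertzSup hertzSup_spec)
open Summit.AtomisticToContinuum.Crystallization.Theorems.FrustratedLawDichotomyStrainedPatchHomCurvLeafL (Ec En naiveK)

/-! ## §2. The parameter-free curvature floor of the centred leaf -/

/-- ★ **The computed curvature floor** of the box `(c, w)` for the label split `Lc, Ln`: best sign-vertex floor minus the remainder
(`none` if the search fails). -/
def curvLamS (c w : (Fin 3 × Fin 3) ⊕ Fin 3 → ℤ) (Lc Ln : List (Fin 3 → ℤ)) : Option ℤ :=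
  (hertzSup (fun i j => (Ec c Lc i j).add (En c w Ln i j)) (Wmat2 c w Lc)).map fun κ => κ - remS2 c w Lc

/-- ★★ **The computed floor passes the leaf**: `curvLamS … = some lamS` and the two label guards ⟹ `curvCheckL2 c w Lc Ln lamS = true`
(then `curv_floor_of_curvCheckL2` gives `(lamS/SC)·‖U(ξ−ξ₀)‖² ≤ Σ segGd …`). [formal bookkeeping] -/
theorem curvCheckL2_of_curvLamS {c w : (Fin 3 × Fin 3) ⊕ Fin 3 → ℤ} {Lc Ln : List (Fin 3 → ℤ)} {lamS : ℤ}
    (h : curvLamS c w Lc Ln = some lamS) (hcen : (Lc.all fun b => labelOK2 c w b) = true) (hnai : (Ln.all fun b => (naiveK c w b).isSome) = true) :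
    curvCheckL2 c w Lc Ln lamS = true := by
  unfold curvLamS at h
  cases hs : hertzSup (fun i j => (Ec c Lc i j).add (En c w Ln i j)) (Wmat2 c w Lc) with
  | none => rw [hs] at h; exact absurd h (by simp)
  | some κ =>
    rw [hs] at h
    simp only [Option.map_some, Option.some.injEq] at h
    have hκ := hertzSup_spec hs
    unfold curvCheckL2
    simp only [Bool.and_eq_true]
    refine ⟨⟨hcen, hnai⟩, ?_⟩
    rw [← h, sub_add_cancel]
    exact hκ

end Summit.AtomisticToContinuum.Crystallization.Theorems.FrustratedLawDichotomyStrainedPatchHomCurvLeafL2
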